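/-
Copyright (c) 2026 the pub-hodgecm-mathlib formalisation cell (harness21).  Prover seat hodgecm-mathlib-K2E4-p18 (g0),
Track B «K2-LIT» ∕ h413, unit «SingularProductFormula» (U2) of the line `K2_E4_SingularTransferKappaSign`, file #18: payment of the socket
`K2E4SingularTransferKappaSign.SingularProductFormula.sig_K2E4KottwitzSignParity` — KOTTWITZ-SIGN PARITY `∏_v e(G′_{γ₀,v}) = 1` AT A RATIONAL
SEMIREGULAR `γ₀`: the anisotropic non-split finite places of the eigenplane `W₂(γ₀) = ker(γ₀ − e₁)` and its definite infinite places are EVEN in number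
(Hilbert reciprocity for `(δ², −d₀d₁)` over `L⁺`).  2026-09-03.
-/
import Literature.NumberTheory.Rogawski1990.TamagawaSingularMembersFinTFCovol   -- ★ p844690: the letters' FRAME (`CanonicalTransferMatrix`, `ArchCanonicalSingularMatrix`, …)
import Literature.NumberTheory.Weil1982.UnitaryFinCentralizerTopFormHaar         -- ★ p850468 (frame import of the socket module)
import Literature.NumberTheory.Rogawski1990.FinExplicitTransferFactorConjLeft     -- ★ (socket-module import; explicit collection `Δ‴`)
import Literature.NumberTheory.Rogawski1990.FinExplicitTransferFactorConjRight    -- ★ (socket-module import)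
import Literature.NumberTheory.Rogawski1990.ArchCanonicalTransferFactor           -- ★ (socket-module import; `ArchTransferFactor`)
import Literature.NumberTheory.Rogawski1990.ExplicitFactorProductFormula          -- ★ (socket-module import; `UnitaryGroup.PlacesOver` idiom, Hilbert reciprocity in product form)
import Literature.NumberTheory.Automorphic.QuadraticHeckeCharacterCM              -- ★ (socket-module import)
import Literature.NumberTheory.Rogawski1990.KottwitzSignProductFormula            -- ★ Kottwitz signs V–VII: `exists_diagonal_frame`; ★ Liu2021 `LemD1BinaryIsotropyOfPlace` (`even_ncard_not_isIsotropic_add_ncard_pos`)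
import Summits.HodgeConjecture.HodgeConjecture.Theorems.K2E4KottwitzSignParityReadings   -- this seat: §1–§3 place readings of the eigenplane in the diagonal frame
import HarnessLib

/-!
# K2_E4 road (h413 = stmt-HodgeConjecture-24833), unit «SingularProductFormula», file #18:
# Kottwitz-sign parity — `#{v ∤ ∞ non-split : W₂(γ₀) anisotropic at v} + #{w ∣ ∞ : W₂(γ₀) definite at w}` is EVEN

Cell `pub/hodgecm-mathlib` (D-0151), Track B (21-frontier RULING «PUSH BOTH» 2026-09-03, director req624, chair K2-lead ORDER #1 §4.4 ∕ ORDER #2,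
naming rule s1813), socket module `Summits/HodgeConjecture/HodgeConjecture/Cruxes/H413/Lines/K2_E4_SingularTransferKappaSignSigsSingularProductFormula.lean`
(planner K2E4-plan (g0), SIGS TABLE `K2/K2E4-plan/g0/SIGS-TABLE.K2E4-g0.md` row #18), socket **`sig_K2E4KottwitzSignParity`** (size L, first rung, all inputs ★):
for `H′ ∈ M₃(L)` hermitian and ANISOTROPIC over the CM field `L` and a rational `γ₀ ∈ U(H′)(L⁺)` SEMIREGULAR — `(γ₀ − e₁)(γ₀ − e₂) = 0`, `e₁ ≠ e₂`, `γ₀` not central,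
`charpoly γ₀ = (X − e₁)²(X − e₂)` (so the `e₁`-eigenspace `W₂(γ₀) = ker(γ₀ − e₁)` is a hermitian PLANE) — the number of finite places `v` of `L⁺` NON-SPLIT in `L`
at which `W₂(γ₀) ⊗ (L ⊗_{L⁺} L⁺_v)` is anisotropic for `H′`, plus the number of infinite places `w` of `L` at which `W₂(γ₀) ⊗_{L,w} ℂ` is anisotropic (= definite), is EVEN.
This is Kottwitz's `∏_v e(G′_{γ₀,v}) = 1` for the `L⁺`-group `G′_{γ₀} = U(W₂) × U(1)` (`e_v = −1` exactly at the places where `U(W₂)` is anisotropic ∕ compact),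
the parity behind «By [Kt₆], §1, d(j) is independent of j» [Rogawski1990, §8.1 p. 117] and «the constant in the limit formula for H′ differs by a sign from that in the
limit formula for H» [Rogawski1990, Prop. 8.2.1 proof p. 119]; classically: HILBERT RECIPROCITY for the quaternion algebra `(δ², −d₀d₁)_{L⁺}` of the hermitian plane
`W₂ ≃ ⟨d₀, d₁⟩` [Landherr1936HermitianForms] [Omeara1963, §71 Thm. 71:18].

THE MATHEMATICS (strategy: the tree's diagonal frame + the place readings of the helper half `Theorems/K2E4KottwitzSignParityReadings.lean` (this seat) + Landherr ∕ Hilbert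
reciprocity already in the tree; no new reciprocity computation).  ★ `exists_diagonal_frame` gives `P ∈ GL₃(L)`, `d : Fin 3 → L` with `ᵗ(σP) H′ P = diag(d₀, d₁, d₂)`,
`σ dᵢ = dᵢ ≠ 0`, `γ₀ P = P diag(a, a, b)`, `{a, b} = {e₁, e₂}` (needs `det H′ ≠ 0` ⇐ anisotropy, `det_ne_zero_of_anisotropic`); the trace pins `a = e₁` (`frame_eq_of_charpoly_eq` — the
one place the socket's characteristic-polynomial hypothesis is consumed).  Then `eigenplane_anisotropic_local_iff` identifies the socket's FINITE set with the finite places at which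
the hermitian plane `((L ⊗ L⁺_v)², diag(d₀, d₁) ⊗ 1)` (★ `Liu2021.LemD1OfPlace.standingData`) is not isotropic, `eigenplane_anisotropic_arch_iff` + `ncard_setOf_embedding_pos_eq`
identify the cardinality of its INFINITE set with the number of real places of `L⁺` at which `d₀ d₁ > 0`, and ★ `Liu2021.LemD1OfPlace.even_ncard_not_isIsotropic_add_ncard_pos`
(Hilbert's reciprocity law ★ `hilbertReciprocity_holds`, O'Meara 71:18, for `(δ², −d₀d₁)` over `L⁺`; `δ² < 0` at every real place, ★ `Liu2021.embedding_of_isReal_lt_zero_of_coe_eq_mul_self`)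
is the parity.

* **`kottwitzSignParity`** — `sig_K2E4KottwitzSignParity` TOKEN FOR TOKEN (frame binders of the socket module copied byte-for-byte).

WHAT IS NOT HERE.  The identification of this parity with the sign of the κ-constants (socket #14 `sig_K2E4ExplicitKappaSign`, #8 `sig_K2E4KottwitzSignOfSheets`) — separate
files; the tree's SIGN-currency form of the same fact is ★ `kottwitzSignAdelic_toAdelic_eq_one` (W19-4).

HONEST LABEL: HC_CM is proved only modulo the 7 printed citations (2 remaining named inputs: hLiu418 = stmt-HodgeConjecture-24832, h413 =
stmt-HodgeConjecture-24833) until rung 0 closes; this file is a `--supports stmt-HodgeConjecture-24833` helper (first rung of the K2_E4 road) and retires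
nothing by itself.

## References
* [Rogawski1990] J. D. Rogawski, *Automorphic Representations of Unitary Groups in Three Variables*, Ann. of Math. Stud. 123 (1990), §8.1 p. 117 (e-text p0116:L1
  «By [Kt₆], §1, d(j) is independent of j»); §8.2 Prop. 8.2.1 proof p. 119 (p0118:L32); §4.1 (4.1.2) pp. 39–40 (the signs `e(γ′)`); §3.8 Prop. 3.8.1 p. 30; §14.5 p. 239.
* [Kottwitz1983] R. E. Kottwitz, *Sign changes in harmonic analysis on reductive groups*, Trans. AMS 278 (1983), 289–297, §1 (`∏_v e(G_v) = 1`).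
* [LanglandsShelstad1987] R. P. Langlands, D. Shelstad, *On the definition of transfer factors*, Math. Ann. 278 (1987), §6.4 Cor. 6.4.B.
* [Landherr1936HermitianForms] W. Landherr, *Äquivalenz Hermitescher Formen über einem beliebigen algebraischen Zahlkörper*, Abh. Math. Sem. Hamburg 11 (1936) 245–248.
* [Omeara1963] O. T. O'Meara, *Introduction to Quadratic Forms* (1963), §63B, §71 Thm. 71:18 (Hilbert reciprocity).
-/

set_option autoImplicit false
-- the mandated namespace repeats the single-problem summit's segment (`HodgeConjecture.HodgeConjecture`)
set_option linter.dupNamespace false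

noncomputable section

open MeasureTheory Measure NumberField IsDedekindDomain
open Literature.MeasureTheory.Group Literature.MeasureTheory.RestrictedProduct
open Literature.Topology.RestrictedProduct Literature.Topology.Algebra.RestrictedProduct
open Literature.NumberTheory.Rogawski1990 Literature.NumberTheory.Automorphic
open Literature.AlgebraicGeometry.ShimuraVarieties (unitaryGroup hermForm)
open scoped Matrix MatrixGroups RestrictedProduct

namespace Summit.HodgeConjecture.HodgeConjecture.Cruxes.H413.K2E4KottwitzSignParity

open Summit.HodgeConjecture.HodgeConjecture.Cruxes.H413.K2E4KottwitzSignParityReadings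

/-! ## The socket `sig_K2E4KottwitzSignParity`, token for token -/

section Frame

variable (L : Type) [Field L] [NumberField L] [IsCMField L]

variable (H' : Matrix (Fin 3) (Fin 3) L) (Tinf : ArchTransferFactor L H')
    -- σ-algebras of the `G′` side (★ (O10-c5) block), of `H_v`, `G_∞`, `H_∞`, and the Haar data — EXACTLY ★ `SingularEllipticTransfer`'s binders
    [∀ g : (UnitaryGroup.cmDatum L 3 H').Adelic, MeasurableSpace ((UnitaryGroup.cmDatum L 3 H').Adelic ⧸ Subgroup.centralizer ({g} : Set (UnitaryGroup.cmDatum L 3 H').Adelic))]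
    [∀ g : (UnitaryGroup.cmDatum L 3 H').Adelic, BorelSpace ((UnitaryGroup.cmDatum L 3 H').Adelic ⧸ Subgroup.centralizer ({g} : Set (UnitaryGroup.cmDatum L 3 H').Adelic))]
    [∀ γ : UnitaryGroup.arch (↥(maximalRealSubfield L)) L (IsCMField.complexConj L) 3 H',
      MeasurableSpace (UnitaryGroup.arch (↥(maximalRealSubfield L)) L (IsCMField.complexConj L) 3 H' ⧸ Subgroup.centralizer ({γ} : Set (UnitaryGroup.arch (↥(maximalRealSubfield L)) L (IsCMField.complexConj L) 3 H')))]
    [∀ γ : UnitaryGroup.arch (↥(maximalRealSubfield L)) L (IsCMField.complexConj L) 3 H',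
      BorelSpace (UnitaryGroup.arch (↥(maximalRealSubfield L)) L (IsCMField.complexConj L) 3 H' ⧸ Subgroup.centralizer ({γ} : Set (UnitaryGroup.arch (↥(maximalRealSubfield L)) L (IsCMField.complexConj L) 3 H')))]
    [∀ (v : HeightOneSpectrum (𝓞 ↥(maximalRealSubfield L))) (γ : (UnitaryGroup.cmDatum L 3 H').Local v),
      MeasurableSpace ((UnitaryGroup.cmDatum L 3 H').Local v ⧸ Subgroup.centralizer ({γ} : Set ((UnitaryGroup.cmDatum L 3 H').Local v)))]
    [∀ (v : HeightOneSpectrum (𝓞 ↥(maximalRealSubfield L))) (γ : (UnitaryGroup.cmDatum L 3 H').Local v),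
      BorelSpace ((UnitaryGroup.cmDatum L 3 H').Local v ⧸ Subgroup.centralizer ({γ} : Set ((UnitaryGroup.cmDatum L 3 H').Local v)))]
    [∀ v : HeightOneSpectrum (𝓞 ↥(maximalRealSubfield L)), MeasurableSpace ((UnitaryGroup.cmDatum L 3 H').Local v)] [∀ v : HeightOneSpectrum (𝓞 ↥(maximalRealSubfield L)), BorelSpace ((UnitaryGroup.cmDatum L 3 H').Local v)]
    [MeasurableSpace (UnitaryGroup.cmDatum L 3 H').Adelic] [BorelSpace (UnitaryGroup.cmDatum L 3 H').Adelic]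
    [MeasurableSpace (UnitaryGroup.arch (↥(maximalRealSubfield L)) L (IsCMField.complexConj L) 3 H')] [BorelSpace (UnitaryGroup.arch (↥(maximalRealSubfield L)) L (IsCMField.complexConj L) 3 H')]
    [∀ γ : (UnitaryGroup.cmDatum L 3 H').Adelic, MeasurableSpace (↥(Subgroup.centralizer ({γ} : Set (UnitaryGroup.cmDatum L 3 H').Adelic)) ⧸
      ((UnitaryGroup.cmDatum L 3 H').quotientSubgroup ⊓ Subgroup.centralizer ({γ} : Set (UnitaryGroup.cmDatum L 3 H').Adelic)).subgroupOf (Subgroup.centralizer ({γ} : Set (UnitaryGroup.cmDatum L 3 H').Adelic)))]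
    [∀ γ : (UnitaryGroup.cmDatum L 3 H').Adelic, BorelSpace (↥(Subgroup.centralizer ({γ} : Set (UnitaryGroup.cmDatum L 3 H').Adelic)) ⧸
      ((UnitaryGroup.cmDatum L 3 H').quotientSubgroup ⊓ Subgroup.centralizer ({γ} : Set (UnitaryGroup.cmDatum L 3 H').Adelic)).subgroupOf (Subgroup.centralizer ({γ} : Set (UnitaryGroup.cmDatum L 3 H').Adelic)))]
    [hCcl : ∀ γ : (UnitaryGroup.cmDatum L 3 H').Adelic, IsClosed ((Subgroup.centralizer ({γ} : Set (UnitaryGroup.cmDatum L 3 H').Adelic) : Subgroup (UnitaryGroup.cmDatum L 3 H').Adelic) : Set (UnitaryGroup.cmDatum L 3 H').Adelic)]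
    [∀ γ : (UnitaryGroup.cmDatum L 3 H').Adelic, (count : Measure ↥(((UnitaryGroup.cmDatum L 3 H').quotientSubgroup ⊓ Subgroup.centralizer ({γ} : Set (UnitaryGroup.cmDatum L 3 H').Adelic)).subgroupOf
      (Subgroup.centralizer ({γ} : Set (UnitaryGroup.cmDatum L 3 H').Adelic)))).IsHaarMeasure]
    [∀ v : HeightOneSpectrum (𝓞 ↥(maximalRealSubfield L)), MeasurableSpace ((UnitaryGroup.cmDatum L 2 (Matrix.of fun i j : Fin 2 => if i.val + j.val + 1 = 2 then (1 : L) else 0)).Local v ×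
        (UnitaryGroup.cmDatum L 1 (Matrix.of fun i j : Fin 1 => if i.val + j.val + 1 = 1 then (1 : L) else 0)).Local v)]
    [∀ v : HeightOneSpectrum (𝓞 ↥(maximalRealSubfield L)), BorelSpace ((UnitaryGroup.cmDatum L 2 (Matrix.of fun i j : Fin 2 => if i.val + j.val + 1 = 2 then (1 : L) else 0)).Local v ×
        (UnitaryGroup.cmDatum L 1 (Matrix.of fun i j : Fin 1 => if i.val + j.val + 1 = 1 then (1 : L) else 0)).Local v)]
    [∀ (v : HeightOneSpectrum (𝓞 ↥(maximalRealSubfield L))) (a : ((UnitaryGroup.cmDatum L 2 (Matrix.of fun i j : Fin 2 => if i.val + j.val + 1 = 2 then (1 : L) else 0)).Local v ×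
        (UnitaryGroup.cmDatum L 1 (Matrix.of fun i j : Fin 1 => if i.val + j.val + 1 = 1 then (1 : L) else 0)).Local v)),
      MeasurableSpace (((UnitaryGroup.cmDatum L 2 (Matrix.of fun i j : Fin 2 => if i.val + j.val + 1 = 2 then (1 : L) else 0)).Local v ×
        (UnitaryGroup.cmDatum L 1 (Matrix.of fun i j : Fin 1 => if i.val + j.val + 1 = 1 then (1 : L) else 0)).Local v) ⧸ Subgroup.centralizer ({a} : Set ((UnitaryGroup.cmDatum L 2 (Matrix.of fun i j : Fin 2 => if i.val + j.val + 1 = 2 then (1 : L) else 0)).Local v ×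
        (UnitaryGroup.cmDatum L 1 (Matrix.of fun i j : Fin 1 => if i.val + j.val + 1 = 1 then (1 : L) else 0)).Local v)))]
    [∀ (v : HeightOneSpectrum (𝓞 ↥(maximalRealSubfield L))) (a : ((UnitaryGroup.cmDatum L 2 (Matrix.of fun i j : Fin 2 => if i.val + j.val + 1 = 2 then (1 : L) else 0)).Local v ×
        (UnitaryGroup.cmDatum L 1 (Matrix.of fun i j : Fin 1 => if i.val + j.val + 1 = 1 then (1 : L) else 0)).Local v)),
      BorelSpace (((UnitaryGroup.cmDatum L 2 (Matrix.of fun i j : Fin 2 => if i.val + j.val + 1 = 2 then (1 : L) else 0)).Local v ×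
        (UnitaryGroup.cmDatum L 1 (Matrix.of fun i j : Fin 1 => if i.val + j.val + 1 = 1 then (1 : L) else 0)).Local v) ⧸ Subgroup.centralizer ({a} : Set ((UnitaryGroup.cmDatum L 2 (Matrix.of fun i j : Fin 2 => if i.val + j.val + 1 = 2 then (1 : L) else 0)).Local v ×
        (UnitaryGroup.cmDatum L 1 (Matrix.of fun i j : Fin 1 => if i.val + j.val + 1 = 1 then (1 : L) else 0)).Local v)))]
    [MeasurableSpace (UnitaryGroup.arch (↥(maximalRealSubfield L)) L (IsCMField.complexConj L) 3 (Matrix.of fun i j : Fin 3 => if i.val + j.val + 1 = 3 then (1 : L) else 0))] [BorelSpace (UnitaryGroup.arch (↥(maximalRealSubfield L)) L (IsCMField.complexConj L) 3 (Matrix.of fun i j : Fin 3 => if i.val + j.val + 1 = 3 then (1 : L) else 0))]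
    [∀ γ : UnitaryGroup.arch (↥(maximalRealSubfield L)) L (IsCMField.complexConj L) 3 (Matrix.of fun i j : Fin 3 => if i.val + j.val + 1 = 3 then (1 : L) else 0),
      MeasurableSpace (UnitaryGroup.arch (↥(maximalRealSubfield L)) L (IsCMField.complexConj L) 3 (Matrix.of fun i j : Fin 3 => if i.val + j.val + 1 = 3 then (1 : L) else 0) ⧸ Subgroup.centralizer ({γ} : Set (UnitaryGroup.arch (↥(maximalRealSubfield L)) L (IsCMField.complexConj L) 3 (Matrix.of fun i j : Fin 3 => if i.val + j.val + 1 = 3 then (1 : L) else 0))))]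
    [∀ γ : UnitaryGroup.arch (↥(maximalRealSubfield L)) L (IsCMField.complexConj L) 3 (Matrix.of fun i j : Fin 3 => if i.val + j.val + 1 = 3 then (1 : L) else 0),
      BorelSpace (UnitaryGroup.arch (↥(maximalRealSubfield L)) L (IsCMField.complexConj L) 3 (Matrix.of fun i j : Fin 3 => if i.val + j.val + 1 = 3 then (1 : L) else 0) ⧸ Subgroup.centralizer ({γ} : Set (UnitaryGroup.arch (↥(maximalRealSubfield L)) L (IsCMField.complexConj L) 3 (Matrix.of fun i j : Fin 3 => if i.val + j.val + 1 = 3 then (1 : L) else 0))))]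
    [MeasurableSpace (UnitaryGroup.arch (↥(maximalRealSubfield L)) L (IsCMField.complexConj L) 2 (Matrix.of fun i j : Fin 2 => if i.val + j.val + 1 = 2 then (1 : L) else 0) ×
          UnitaryGroup.arch (↥(maximalRealSubfield L)) L (IsCMField.complexConj L) 1 (Matrix.of fun i j : Fin 1 => if i.val + j.val + 1 = 1 then (1 : L) else 0))]
    [BorelSpace (UnitaryGroup.arch (↥(maximalRealSubfield L)) L (IsCMField.complexConj L) 2 (Matrix.of fun i j : Fin 2 => if i.val + j.val + 1 = 2 then (1 : L) else 0) ×
          UnitaryGroup.arch (↥(maximalRealSubfield L)) L (IsCMField.complexConj L) 1 (Matrix.of fun i j : Fin 1 => if i.val + j.val + 1 = 1 then (1 : L) else 0))]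
    [∀ a : (UnitaryGroup.arch (↥(maximalRealSubfield L)) L (IsCMField.complexConj L) 2 (Matrix.of fun i j : Fin 2 => if i.val + j.val + 1 = 2 then (1 : L) else 0) ×
          UnitaryGroup.arch (↥(maximalRealSubfield L)) L (IsCMField.complexConj L) 1 (Matrix.of fun i j : Fin 1 => if i.val + j.val + 1 = 1 then (1 : L) else 0)),
      MeasurableSpace ((UnitaryGroup.arch (↥(maximalRealSubfield L)) L (IsCMField.complexConj L) 2 (Matrix.of fun i j : Fin 2 => if i.val + j.val + 1 = 2 then (1 : L) else 0) ×
          UnitaryGroup.arch (↥(maximalRealSubfield L)) L (IsCMField.complexConj L) 1 (Matrix.of fun i j : Fin 1 => if i.val + j.val + 1 = 1 then (1 : L) else 0)) ⧸ Subgroup.centralizer ({a} : Set (UnitaryGroup.arch (↥(maximalRealSubfield L)) L (IsCMField.complexConj L) 2 (Matrix.of fun i j : Fin 2 => if i.val + j.val + 1 = 2 then (1 : L) else 0) ×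
          UnitaryGroup.arch (↥(maximalRealSubfield L)) L (IsCMField.complexConj L) 1 (Matrix.of fun i j : Fin 1 => if i.val + j.val + 1 = 1 then (1 : L) else 0))))]
    [∀ a : (UnitaryGroup.arch (↥(maximalRealSubfield L)) L (IsCMField.complexConj L) 2 (Matrix.of fun i j : Fin 2 => if i.val + j.val + 1 = 2 then (1 : L) else 0) ×
          UnitaryGroup.arch (↥(maximalRealSubfield L)) L (IsCMField.complexConj L) 1 (Matrix.of fun i j : Fin 1 => if i.val + j.val + 1 = 1 then (1 : L) else 0)),
      BorelSpace ((UnitaryGroup.arch (↥(maximalRealSubfield L)) L (IsCMField.complexConj L) 2 (Matrix.of fun i j : Fin 2 => if i.val + j.val + 1 = 2 then (1 : L) else 0) ×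
          UnitaryGroup.arch (↥(maximalRealSubfield L)) L (IsCMField.complexConj L) 1 (Matrix.of fun i j : Fin 1 => if i.val + j.val + 1 = 1 then (1 : L) else 0)) ⧸ Subgroup.centralizer ({a} : Set (UnitaryGroup.arch (↥(maximalRealSubfield L)) L (IsCMField.complexConj L) 2 (Matrix.of fun i j : Fin 2 => if i.val + j.val + 1 = 2 then (1 : L) else 0) ×
          UnitaryGroup.arch (↥(maximalRealSubfield L)) L (IsCMField.complexConj L) 1 (Matrix.of fun i j : Fin 1 => if i.val + j.val + 1 = 1 then (1 : L) else 0))))]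
    (νH : ∀ v : HeightOneSpectrum (𝓞 ↥(maximalRealSubfield L)), Measure ((UnitaryGroup.cmDatum L 2 (Matrix.of fun i j : Fin 2 => if i.val + j.val + 1 = 2 then (1 : L) else 0)).Local v ×
        (UnitaryGroup.cmDatum L 1 (Matrix.of fun i j : Fin 1 => if i.val + j.val + 1 = 1 then (1 : L) else 0)).Local v))
    (νG : ∀ v : HeightOneSpectrum (𝓞 ↥(maximalRealSubfield L)), Measure ((UnitaryGroup.cmDatum L 3 H').Local v))
    [∀ v, IsFiniteMeasureOnCompacts (νH v)] [∀ v, (νH v).IsMulRightInvariant]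
    [∀ v, (νG v).IsHaarMeasure] [∀ v, (νG v).IsMulRightInvariant]  -- MAIN-b's strength (F2): `νG_v` Haar
    (νGi : Measure (UnitaryGroup.arch (↥(maximalRealSubfield L)) L (IsCMField.complexConj L) 3 H')) (νqi : Measure (UnitaryGroup.arch (↥(maximalRealSubfield L)) L (IsCMField.complexConj L) 3 (Matrix.of fun i j : Fin 3 => if i.val + j.val + 1 = 3 then (1 : L) else 0)))
    (νHi : Measure (UnitaryGroup.arch (↥(maximalRealSubfield L)) L (IsCMField.complexConj L) 2 (Matrix.of fun i j : Fin 2 => if i.val + j.val + 1 = 2 then (1 : L) else 0) ×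
          UnitaryGroup.arch (↥(maximalRealSubfield L)) L (IsCMField.complexConj L) 1 (Matrix.of fun i j : Fin 1 => if i.val + j.val + 1 = 1 then (1 : L) else 0)))
    [IsFiniteMeasureOnCompacts νGi] [νGi.IsMulRightInvariant] [IsFiniteMeasureOnCompacts νqi] [νqi.IsMulRightInvariant]
    [IsFiniteMeasureOnCompacts νHi] [νHi.IsMulRightInvariant]

set_option linter.unusedSectionVars false in  -- the socket's frame (★ p844690 binders, copied byte-for-byte) auto-includes the adelic Borel ∕ closed-centraliser ∕ counting-Haar instances, unused by THIS statement; they are kept so that the type is the socket's, token for token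
/-- **PAYMENT OF `sig_K2E4KottwitzSignParity`** (socket #18 of unit «SingularProductFormula» of the K2_E4 road,
`Cruxes/H413/Lines/K2_E4_SingularTransferKappaSignSigsSingularProductFormula.lean`, statement bytes frozen) — KOTTWITZ-SIGN PARITY (`∏_v e(G′_{γ₀,v}) = 1`, via Hilbert
reciprocity for `−det W₂(γ₀)` against `disc(L∕L⁺)`): for `H′` hermitian anisotropic over the CM field `L` and a rational semiregular `γ₀ ∈ U(H′)(L⁺)`
(`(γ₀ − e₁)(γ₀ − e₂) = 0`, `e₁ ≠ e₂`, `γ₀` not central, `charpoly γ₀ = (X − e₁)²(X − e₂)`), the number of finite non-split places `v` at which the `e₁`-eigenplane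
`W₂(γ₀) = ker(γ₀ − e₁)` is anisotropic plus the number of infinite places at which it is definite is EVEN.  Proof: the tree's diagonal frame ★ `exists_diagonal_frame`
(`ᵗ(σP) H′ P = diag(d₀,d₁,d₂)`, `γ₀ P = P diag(a,a,b)`), whose double eigenvalue is `e₁` by the trace (★ `frame_eq_of_charpoly_eq`); the readings ★ `eigenplane_anisotropic_local_iff` ∕ `eigenplane_anisotropic_arch_iff` identify the socket's two sets with the
anisotropic finite places and the definite real places of the hermitian plane `⟨d₀, d₁⟩` over `L ∕ L⁺`; ★ `Liu2021.LemD1OfPlace.even_ncard_not_isIsotropic_add_ncard_pos`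
— Hilbert's reciprocity law ★ `hilbertReciprocity_holds` for `(δ², −d₀d₁)` over `L⁺`, `δ² < 0` at every real place — is the parity.  (The carried data `hK`, `Sbad`, `Δ`,
the measure families, `hCTM`, `hACS` and the partner `γ_H` are not used.)
[cite: Rogawski1990, §8.1 p. 117; §8.2 Prop. 8.2.1 proof p. 119; §4.1 (4.1.2) pp. 39–40; §3.8 Prop. 3.8.1 p. 30] [cite: Kottwitz1983, §1]
[cite: LanglandsShelstad1987, §6.4 Cor. 6.4.B] [cite: Landherr1936HermitianForms] [cite: Omeara1963, §71 Thm. 71:18] -/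
theorem kottwitzSignParity :
        ∀ (hK : ∀ v : HeightOneSpectrum (𝓞 ↥(maximalRealSubfield L)), νG v (UnitaryGroup.cmLocalIntegralLevel L 3 H' v : Set ((UnitaryGroup.cmDatum L 3 H').Local v)) = 1)
          (hanis : ∀ x : Fin 3 → L, hermForm (cmConjRingHom L) H' x x = 0 → x = 0)
          (Sbad : Finset (HeightOneSpectrum (𝓞 ↥(maximalRealSubfield L))))
              (Δ : ∀ v : HeightOneSpectrum (𝓞 ↥(maximalRealSubfield L)), LocalTransferFactor L H' v)
              (mH : ∀ v : HeightOneSpectrum (𝓞 ↥(maximalRealSubfield L)),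
                OrbitalMeasureFamily ((UnitaryGroup.cmDatum L 2 (Matrix.of fun i j : Fin 2 => if i.val + j.val + 1 = 2 then (1 : L) else 0)).Local v ×
                  (UnitaryGroup.cmDatum L 1 (Matrix.of fun i j : Fin 1 => if i.val + j.val + 1 = 1 then (1 : L) else 0)).Local v))
              (mG : ∀ v : HeightOneSpectrum (𝓞 ↥(maximalRealSubfield L)), OrbitalMeasureFamily ((UnitaryGroup.cmDatum L 3 H').Local v))
          (m' : OrbitalMeasureFamily (UnitaryGroup.arch (↥(maximalRealSubfield L)) L (IsCMField.complexConj L) 3 H'))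
                (m : OrbitalMeasureFamily (UnitaryGroup.arch (↥(maximalRealSubfield L)) L (IsCMField.complexConj L) 3
                  (Matrix.of fun i j : Fin 3 => if i.val + j.val + 1 = 3 then (1 : L) else 0)))
                (mHi : OrbitalMeasureFamily (UnitaryGroup.arch (↥(maximalRealSubfield L)) L (IsCMField.complexConj L) 2
                    (Matrix.of fun i j : Fin 2 => if i.val + j.val + 1 = 2 then (1 : L) else 0) ×
                  UnitaryGroup.arch (↥(maximalRealSubfield L)) L (IsCMField.complexConj L) 1
                    (Matrix.of fun i j : Fin 1 => if i.val + j.val + 1 = 1 then (1 : L) else 0)))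
                (t' : ∀ γ' : UnitaryGroup.arch (↥(maximalRealSubfield L)) L (IsCMField.complexConj L) 3 H',
                  Measure (Subgroup.centralizer ({γ'} : Set (UnitaryGroup.arch (↥(maximalRealSubfield L)) L (IsCMField.complexConj L) 3 H'))))
                (t : ∀ γ : UnitaryGroup.arch (↥(maximalRealSubfield L)) L (IsCMField.complexConj L) 3
                    (Matrix.of fun i j : Fin 3 => if i.val + j.val + 1 = 3 then (1 : L) else 0),
                  Measure (Subgroup.centralizer ({γ} : Set (UnitaryGroup.arch (↥(maximalRealSubfield L)) L (IsCMField.complexConj L) 3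
                    (Matrix.of fun i j : Fin 3 => if i.val + j.val + 1 = 3 then (1 : L) else 0)))))
                (tH : ∀ γH : UnitaryGroup.arch (↥(maximalRealSubfield L)) L (IsCMField.complexConj L) 2
                      (Matrix.of fun i j : Fin 2 => if i.val + j.val + 1 = 2 then (1 : L) else 0) ×
                    UnitaryGroup.arch (↥(maximalRealSubfield L)) L (IsCMField.complexConj L) 1
                      (Matrix.of fun i j : Fin 1 => if i.val + j.val + 1 = 1 then (1 : L) else 0),
                  Measure (Subgroup.centralizer ({γH} : Set (UnitaryGroup.arch (↥(maximalRealSubfield L)) L (IsCMField.complexConj L) 2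
                      (Matrix.of fun i j : Fin 2 => if i.val + j.val + 1 = 2 then (1 : L) else 0) ×
                    UnitaryGroup.arch (↥(maximalRealSubfield L)) L (IsCMField.complexConj L) 1
                      (Matrix.of fun i j : Fin 1 => if i.val + j.val + 1 = 1 then (1 : L) else 0)))))
            (hherm : (H'.map (cmConjRingHom L)).transpose = H')
            (hCTM : CanonicalTransferMatrix L H' Tinf.Δ νH νG Sbad Δ mH mG)
            (hACS : ArchCanonicalSingularMatrix L H' Tinf νGi νqi νHi hanis m' m mHi t' t tH),
              ∀ (γ₀ : (UnitaryGroup.cmDatum L 3 H').Rational) (e₁ e₂ : L), e₁ ≠ e₂ →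
                ((((γ₀ : unitaryGroup (cmConjRingHom L) H').val : GL (Fin 3) L) : Matrix (Fin 3) (Fin 3) L) - e₁ • (1 : Matrix (Fin 3) (Fin 3) L)) * ((((γ₀ : unitaryGroup (cmConjRingHom L) H').val : GL (Fin 3) L) : Matrix (Fin 3) (Fin 3) L) - e₂ • (1 : Matrix (Fin 3) (Fin 3) L)) = 0 →
                (¬ ∃ ζ : L, (((γ₀ : unitaryGroup (cmConjRingHom L) H').val : GL (Fin 3) L) : Matrix (Fin 3) (Fin 3) L) = ζ • (1 : Matrix (Fin 3) (Fin 3) L)) →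
                (((γ₀ : unitaryGroup (cmConjRingHom L) H').val : GL (Fin 3) L) : Matrix (Fin 3) (Fin 3) L).charpoly =
                  (Polynomial.X - Polynomial.C e₁) ^ 2 * (Polynomial.X - Polynomial.C e₂) →
                ∀ (γH : (UnitaryGroup.cmDatum L 2 (Matrix.of fun i j : Fin 2 => if i.val + j.val + 1 = 2 then (1 : L) else 0)).Rational ×
                    (UnitaryGroup.cmDatum L 1 (Matrix.of fun i j : Fin 1 => if i.val + j.val + 1 = 1 then (1 : L) else 0)).Rational),
                  (((γH.1 : unitaryGroup (cmConjRingHom L) (Matrix.of fun i j : Fin 2 => if i.val + j.val + 1 = 2 then (1 : L) else 0)).val : GL (Fin 2) L) : Matrix (Fin 2) (Fin 2) L) =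
                    e₁ • (1 : Matrix (Fin 2) (Fin 2) L) →
                  (((γH.2 : unitaryGroup (cmConjRingHom L) (Matrix.of fun i j : Fin 1 => if i.val + j.val + 1 = 1 then (1 : L) else 0)).val : GL (Fin 1) L) : Matrix (Fin 1) (Fin 1) L) 0 0 = e₂ →
                  Even (Set.ncard {v : HeightOneSpectrum (𝓞 ↥(maximalRealSubfield L)) | Subsingleton (UnitaryGroup.PlacesOver L v) ∧
                    (∀ x : Fin 3 → UnitaryGroup.LocalRing L v,
                      Matrix.mulVec (((((γ₀ : unitaryGroup (cmConjRingHom L) H').val : GL (Fin 3) L) : Matrix (Fin 3) (Fin 3) L)).map (algebraMap L (UnitaryGroup.LocalRing L v)) -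
                          algebraMap L (UnitaryGroup.LocalRing L v) e₁ • (1 : Matrix (Fin 3) (Fin 3) (UnitaryGroup.LocalRing L v))) x = 0 →
                      (∑ i, ∑ j, UnitaryGroup.conjLocal L (IsCMField.complexConj L) v (x i) * algebraMap L (UnitaryGroup.LocalRing L v) (H' i j) * x j) = 0 →
                      x = 0)} +
                    Set.ncard {w : NumberField.InfinitePlace L |
                    (∀ x : Fin 3 → ℂ,
                      Matrix.mulVec (((((γ₀ : unitaryGroup (cmConjRingHom L) H').val : GL (Fin 3) L) : Matrix (Fin 3) (Fin 3) L)).map w.embedding - w.embedding e₁ • (1 : Matrix (Fin 3) (Fin 3) ℂ)) x = 0 →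
                      (∑ i, ∑ j, starRingEnd ℂ (x i) * w.embedding (H' i j) * x j) = 0 → x = 0)}) := by
  intro _hK hanis _Sbad _Δ _mH _mG _m' _m _mHi _t' _t _tH hherm _hCTM _hACS γ₀ e₁ e₂ hne hprod hns hchar _γH _hγH₁ _hγH₂
  classical
  -- §2: the diagonal frame of the tree, double eigenvalue pinned to `e₁`
  have hdet : H'.det ≠ 0 := det_ne_zero_of_anisotropic (cmConjRingHom L) H' hanis
  have h2 : (1 : L) + 1 ≠ 0 := by norm_num
  obtain ⟨a, b, P, d, hab, -, -, hd, hd0, hP, hγP⟩ :=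
    exists_diagonal_frame (cmConjRingHom L) (fun x => by rw [cmConjRingHom_apply, cmConjRingHom_apply, IsCMField.complexConj_apply_apply]) h2 H' hherm hdet
      (γ₀ : unitaryGroup (cmConjRingHom L) H') hne hprod (fun h => hns ⟨e₁, h⟩) (fun h => hns ⟨e₂, h⟩)
  rw [finSum_smul_one_eq_diagonal] at hγP
  obtain ⟨hae, hbe⟩ := frame_eq_of_charpoly_eq _ P hne hab hγP hchar
  rw [hae, hbe] at hγP
  -- a purely imaginary `δ ≠ 0`
  obtain ⟨x, hx⟩ : ∃ x : L, IsCMField.complexConj L x ≠ x := by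
    by_contra! h
    exact IsCMField.complexConj_ne_one L (AlgEquiv.ext h)
  set δ : L := x - IsCMField.complexConj L x with hδdef
  have hcδ : IsCMField.complexConj L δ = -δ := by rw [hδdef, map_sub, IsCMField.complexConj_apply_apply, neg_sub]
  have hδ : δ ≠ 0 := fun h0 => hx (sub_eq_zero.1 h0).symm
  -- the plane's diagonal `(d₀, d₁)`, real and non-degenerate
  have hdc : ∀ i, IsCMField.complexConj L (d i) = d i := fun i => by rw [← cmConjRingHom_apply]; exact hd i
  let t : Fin 2 → maximalRealSubfield L := fun i => ⟨d (Fin.castSucc i), (IsCMField.complexConj_eq_self_iff (K := L) _).1 (hdc _)⟩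
  have hJ : Matrix.diagonal ![d 0, d 1] = (Matrix.diagonal t).map (algebraMap (maximalRealSubfield L) L) := by
    rw [Matrix.diagonal_map (map_zero _)]
    congr 1
    funext i; fin_cases i <;> rfl
  have ht : ∀ i, t i ≠ 0 := fun i h => hd0 _ (congrArg Subtype.val h)
  have hJh : ((Matrix.diagonal ![d 0, d 1]).map (IsCMField.complexConj L))ᵀ = Matrix.diagonal ![d 0, d 1] := by
    rw [Matrix.diagonal_map (map_zero _), Matrix.diagonal_transpose]
    congr 1
    funext i; fin_cases i
    · exact hdc 0
    · exact hdc 1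
  have hJdet : (Matrix.diagonal ![d 0, d 1]).det ≠ 0 := by
    rw [Matrix.det_diagonal, Fin.prod_univ_two]
    exact mul_ne_zero (hd0 0) (hd0 1)
  let dd : maximalRealSubfield L :=
    ⟨δ * δ, (IsCMField.complexConj_eq_self_iff (K := L) (δ * δ)).1 (by rw [map_mul, hcδ, neg_mul_neg])⟩
  have hdd : δ * δ = algebraMap (maximalRealSubfield L) L dd := rfl
  have hdneg : ∀ (w : InfinitePlace (maximalRealSubfield L)) (hw : w.IsReal), InfinitePlace.embedding_of_isReal hw dd < 0 :=
    fun w hw => Liu2021.embedding_of_isReal_lt_zero_of_coe_eq_mul_self hcδ hδ rfl w hw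
  -- Hilbert reciprocity: anisotropic finite places + definite real places of the plane are EVEN
  have hpar := Liu2021.LemD1OfPlace.even_ncard_not_isIsotropic_add_ncard_pos L (IsCMField.complexConj L) hcδ hδ t hJ hJh hJdet hdd ht hdneg
  -- §3: the socket's two sets are those
  have hfin : {v : HeightOneSpectrum (𝓞 ↥(maximalRealSubfield L)) | Subsingleton (UnitaryGroup.PlacesOver L v) ∧
      (∀ x : Fin 3 → UnitaryGroup.LocalRing L v,
        Matrix.mulVec (((((γ₀ : unitaryGroup (cmConjRingHom L) H').val : GL (Fin 3) L) : Matrix (Fin 3) (Fin 3) L)).map (algebraMap L (UnitaryGroup.LocalRing L v)) -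
            algebraMap L (UnitaryGroup.LocalRing L v) e₁ • (1 : Matrix (Fin 3) (Fin 3) (UnitaryGroup.LocalRing L v))) x = 0 →
        (∑ i, ∑ j, UnitaryGroup.conjLocal L (IsCMField.complexConj L) v (x i) * algebraMap L (UnitaryGroup.LocalRing L v) (H' i j) * x j) = 0 →
        x = 0)} =
      {v : HeightOneSpectrum (𝓞 ↥(maximalRealSubfield L)) | ¬ Liu2021.LemD1.IsIsotropic
        (Liu2021.LemD1OfPlace.standingData L v (IsCMField.complexConj L) 2 (Matrix.diagonal ![d 0, d 1]) hcδ hδ le_rfl hJh hJdet)} :=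
    Set.ext fun v => eigenplane_anisotropic_local_iff v γ₀ hne hP hγP hcδ hδ hJh hJdet
  have ht01 : ((t 0 * t 1 : maximalRealSubfield L) : L) = d 0 * d 1 := rfl
  have hinf : {w : NumberField.InfinitePlace L |
      (∀ x : Fin 3 → ℂ,
        Matrix.mulVec (((((γ₀ : unitaryGroup (cmConjRingHom L) H').val : GL (Fin 3) L) : Matrix (Fin 3) (Fin 3) L)).map w.embedding - w.embedding e₁ • (1 : Matrix (Fin 3) (Fin 3) ℂ)) x = 0 →
        (∑ i, ∑ j, starRingEnd ℂ (x i) * w.embedding (H' i j) * x j) = 0 → x = 0)} =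
      {w : InfinitePlace L | 0 < (w.embedding ((t 0 * t 1 : maximalRealSubfield L) : L)).re} :=
    Set.ext fun w => by rw [Set.mem_setOf_eq, Set.mem_setOf_eq, ht01]; exact eigenplane_anisotropic_arch_iff w γ₀ hne hd hd0 hP hγP
  rw [hfin, hinf, ncard_setOf_embedding_pos_eq L (t 0 * t 1)]
  exact hpar

end Frame

end Summit.HodgeConjecture.HodgeConjecture.Cruxes.H413.K2E4KottwitzSignParity

end
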